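import Summits.QuantumFields.BalabanUV.T4Continuum.Support.CTCovariantLaplacianDecay
import Summits.QuantumFields.BalabanUV.T4Continuum.Spine.NE2BalabanRoot
import Summits.QuantumFields.BalabanUV.T4Continuum.Support.RegularTransportersContour

/-!
# T⁴ programme, spine node NE2 (U1a), sub-row Δ3 «NE2-WALK» (T4-DAG `T4-U1a.S-NE2-D3-WALK°`) — THE CONJUGATED (H-bd) OF ROW B3's
# AVERAGING SUMMAND `a·n^d·(Q_k(R)ᴴQ_k(R) − (Q_kᴴQ_k)⊗1)`: rectangular Schur conjugation of the block averagings with the CORNER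
# weight on the unit index, the Gram difference under conjugation, and `hPc` for `NE2BalabanRoot.avgPert` from `hreg` and `hJ`

NE2 formalisation swarm `b2b-balaban-t4-ne2-formalise-*`, leaf prover 06 (gen 3), supplier item «Δ3-CT-HBD-B3» (INTENT CLAIMS.log l.15494;
follower of «Δ3-CT» p220700∕p220892 and «Δ3-CT-HBD» p221704∕p221931, owner ruling R21 (c)).  «Δ3-CT» re-typed the decay binder of
`Spine/NE2BalabanDecayRate` as `hdec ⇐ hW ∧ hPc`; «Δ3-CT-HBD» proved `hPc` for ROW B2's summand `covPertC R` from the (3.35)-class + the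
`U = 1` conjugation defect `hJ`.  THIS FILE does the same for ROW B3's summand, Bałaban's averaging perturbation
`avgPert R k = a·n_k^d·(Q_k(R_k)ᴴQ_k(R_k) − (Q_kᴴQ_k)⊗1)` (`NE2BalabanRoot.avgPert`; by `CovariantBlockAveraging.gram_eq` it is
`a·((B_k + E_k)ᴴ(B_k + E_k) − B_kᴴB_k)` with the free inner averaging `B_k = Bfree` and the transport error `E_k = Ecov R`):

 * §1 THE RECTANGULAR SCHUR CONJUGATION: for a kernel `X` from the fine index `idx L M k × o` to the unit index `(Tor M × Fin d) × o`
   DOMINATED by King's modulus kernel, `‖X (b,c) (i,c′)‖ ≤ m·qr b i` (`DeltaACombesThomas.qr`: row sums `1`, column sums `n^{−d}`), and a fine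
   weight `ρ` whose STENCIL OSCILLATION is `≤ Λ` (the `hL` shape; `CTKingTowerWeights.abs_rho_stencil_le` gives `Λ = 2` for the canonical
   weights), with the CORNER weight `σ b = ρ (n_k·b + 0, μ_b)` on the unit index: **`opNorm_conjMat_sub_le_of_qr`**
   `‖conjMat κ σ ρ X − X‖ ≤ (e^{|κ|Λ} − 1)·m·card o·(√(n^d))⁻¹` (geometric mean of the row and column sums — the `n`-uniformity), hence for the
   isometrically normalised averagings **`opNorm_conjMat_Bfree_sub_le`** (`‖c(B_k) − B_k‖ ≤ card o·(e^{|κ|Λ} − 1)`, `m = 1` by `norm_QvOp_le`)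
   and **`opNorm_conjMat_Ecov_sub_le`** (`‖c(E_k) − E_k‖ ≤ card o·(e^{|κ|Λ} − 1)·τ`, `m = τ` by `norm_Qcov_sub_kron_apply_le`, `τ` = the size of
   the contour transporters' deviation from `1`);
 * §2 THE GRAM DIFFERENCE UNDER CONJUGATION: `c((B+E)ᴴ(B+E) − BᴴB) = c(B+E)†·c(B+E) − c(B)†·c(B)` with the MIDDLE weight `σ`
   (`conjMat_mul`, `conjMat_conjTranspose`), so **`opNorm_conjMat_gram_le`** `≤ Γ := (b + e′)·e′ + e′·b′` for `‖c_{±κ}(B)‖ ≤ b, b′`, `‖c_{±κ}(E)‖ ≤ e′`;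
 * §3 ON BAŁABAN's (3.35)-CLASS (`RegularTransporters R α β`, row B5): `τ = e^{(d+1)α} − 1` (`RegularTransportersContour`), `‖E_k‖ ≤ card o·τ`
   (`opNorm_Ecov_le`), **`opNorm_conjMat_avgPert_le`** `‖c(avgPert R k)‖ ≤ a·GammaAvg (card o) d α κ` at the canonical weights (Λ = 2) —
   VANISHING with the background like the un-conjugated `kappaQ` —, and **`hPc_avgPert_of_regular`**:
   `‖c(avgPert R k)·c((Δ_a^{(k)}⊗1)⁻¹)‖ ≤ kappaAvgCT (card o) d a α J κ = a·GammaAvg·(γ_D − J)⁻¹` from `hreg` and the displayed `U = 1` input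
   `hJ : ∀ k y, ConjDefect (Δ_a^{(k)}) κ (rho k y) J` — NO `hNE3` (sizes only).

HONEST FRAMING (T4-DAG p. 1).  Bookkeeping over landed modules ([folklore]); statements and the constants `GammaAvg`, `kappaAvgCT` OURS; MODEL
level (King's block means with contour transport as DATA — the (α) presentation of row B3.a′; no B0); `hJ` DISPLAYED (U = 1 core, substrate VEC
∕ β-cell modulo `∂P∂*`); the gauge slot `P₄` (row B4) is NOT treated — for ROOT B's `P_B = covPertC + avgPert + P₄` its conjugated (H-bd)
stays displayed (file D2); Δ3 NOT closed; NE2 (U1a) NOT PROVED; NE3 OPEN; spine PROVED 0/9 unchanged; NOT infinite volume, NOT a mass gap,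
NOT the Clay problem, NOT summit progress.  HONEST DEPENDENCY: continuum YM on T⁴ ⇐ BetaPertH ∧ nine spine estimates (0/9 proved); BetaPertH ⇐
(D1) ∧ (D4) ∧ CAP+tail; G-an2-4 gates asym, D1 and NE2/3/4.  ABSOLUTE RULE kept; no `sorry`.
-/

noncomputable section

open scoped BigOperators ComplexConjugate Matrix Matrix.Norms.L2Operator Kronecker

namespace Summit.QuantumFields.BalabanUV.T4Continuum.CTAveragingSummandHbd

open Literature.MathematicalPhysics.QuantumFieldTheory.Balaban1983to89.B5Prop11Plancherel (Cst Cst_nonneg Tor fine unitVec)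
open Literature.MathematicalPhysics.QuantumFieldTheory.Balaban1983to89.B5G183RateUnitTower (lev lev_neZero)
open Literature.MathematicalPhysics.QuantumFieldTheory.Balaban1983to89.B5Block118 (QvOp bpt tstep tstep_zero)
open Literature.MathematicalPhysics.QuantumFieldTheory.Balaban1983to89.Beta.DeltaACombesThomas (qr qr_nonneg norm_QvOp_le qr_ne_zero
  sum_qr_row sum_qr_col)
open Summit.QuantumFields.BalabanUV.T4Continuum
open Summit.QuantumFields.BalabanUV.T4Continuum.BalabanAveragedTowerUnit (idx one_le_lev')
open Summit.QuantumFields.BalabanUV.T4Continuum.KingPairingPlantedLaw (calDalev)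
open Summit.QuantumFields.BalabanUV.T4Continuum.CovariantBlockAveraging (Qcov transport contour Bfree Ecov QcovLev sqrtVol norm_sqrtVol
  opNorm_Bfree_le opNorm_Ecov_le gram_eq norm_Qcov_sub_kron_apply_le opNorm_le_sqrt_of_schur)
open Summit.QuantumFields.BalabanUV.T4Continuum.RegularBackgroundTower (RegularTransporters)
open Summit.QuantumFields.BalabanUV.T4Continuum.RegularTransportersPerBond (norm_transporter_sub_one_le)
open Summit.QuantumFields.BalabanUV.T4Continuum.RegularTransportersContour (norm_transport_contour_sub_one_le_of_regular)
open Summit.QuantumFields.BalabanUV.T4Continuum.NE2BalabanRoot (avgPert)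
open Summit.QuantumFields.BalabanUV.T4Continuum.CTWeightedCoercivity
open Summit.QuantumFields.BalabanUV.T4Continuum.CTConjugationPieces (opNorm_conjMat_le_add opNorm_conjMat_sub_le_schur conjMat_conjTranspose)
open Summit.QuantumFields.BalabanUV.T4Continuum.CTAveragedTowerDecay (opNorm_conjMat_kron_inv_le_of_wCoercive)
open Summit.QuantumFields.BalabanUV.T4Continuum.CTConjugatedHbd (wCoercive_calDa_of_conjDefect)
open Summit.QuantumFields.BalabanUV.T4Continuum.CTKingTowerWeights (rho abs_rho_stencil_le)
open Summit.QuantumFields.BalabanUV.T4Continuum.DirichletRegionTower (gamD gamD_pos)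

variable {d : ℕ} (L : ℕ) [NeZero L] (M : Fin d → ℕ) [hM : ∀ μ, NeZero (M μ)]
variable {o : Type*} [Fintype o] [DecidableEq o]

/-! ## §1 The rectangular Schur conjugation of the block averagings with the corner weight -/

section Schur

variable (n : ℕ) [NeZero n]

/-- the CORNER WEIGHT on the unit index: `σ(y, μ) = ρ(n·y + 0, μ)` — the fine weight read at the corner of the block. [folklore] -/
abbrev cornerW (ρ : Tor (fine n M) × Fin d → ℝ) : Tor M × Fin d → ℝ := fun b => ρ (bpt n M b.1 0, b.2)

omit hM in
/-- on the support of King's modulus kernel the corner weight and the fine weight differ by at most the stencil oscillation `Λ`.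
[folklore] -/
theorem abs_cornerW_sub_le {ρ : Tor (fine n M) × Fin d → ℝ} {Λ : ℝ}
    (hΛ : ∀ (z : Tor M) (μ : Fin d) (j j' : Fin d → Fin n) (t t' : ℕ), t < n → t' < n →
      |ρ (bpt n M z j + tstep (fine n M) μ t, μ) - ρ (bpt n M z j' + tstep (fine n M) μ t', μ)| ≤ Λ)
    (b : Tor M × Fin d) (i : Tor (fine n M) × Fin d) (h : qr n M b i ≠ 0) : |cornerW M n ρ b - ρ i| ≤ Λ := by
  obtain ⟨j, t, hi⟩ := qr_ne_zero n M b i h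
  have hn : 0 < n := Nat.pos_of_ne_zero (NeZero.ne n)
  have e : bpt n M b.1 0 = bpt n M b.1 0 + tstep (fine n M) b.2 0 := by rw [tstep_zero, add_zero]
  rw [hi, cornerW, e]
  exact hΛ b.1 b.2 0 j 0 t hn t.is_lt

/-- **THE RECTANGULAR SCHUR CONJUGATION BOUND**: a kernel dominated by `m·qr` (King's modulus kernel of `Q_k`, (1.18): row sums `1`, column
sums `n^{−d}`) under the conjugation with the corner weight on the unit index and a fine weight of stencil oscillation `≤ Λ` moves by at most
`(e^{|κ|Λ} − 1)·m·card o·(√(n^d))⁻¹` in operator norm. [folklore] -/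
theorem opNorm_conjMat_sub_le_of_qr {X : Matrix ((Tor M × Fin d) × o) ((Tor (fine n M) × Fin d) × o) ℂ} {m : ℝ} (hm : 0 ≤ m)
    (hX : ∀ b i, ‖X b i‖ ≤ m * qr n M b.1 i.1) {ρ : Tor (fine n M) × Fin d → ℝ} {Λ : ℝ} (hΛ0 : 0 ≤ Λ)
    (hΛ : ∀ (z : Tor M) (μ : Fin d) (j j' : Fin d → Fin n) (t t' : ℕ), t < n → t' < n →
      |ρ (bpt n M z j + tstep (fine n M) μ t, μ) - ρ (bpt n M z j' + tstep (fine n M) μ t', μ)| ≤ Λ) (κ : ℝ) :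
    ‖conjMat κ (fun b : (Tor M × Fin d) × o => cornerW M n ρ b.1) (fun p : (Tor (fine n M) × Fin d) × o => ρ p.1) X - X‖
      ≤ (Real.exp (|κ| * Λ) - 1) * m * Fintype.card o * (Real.sqrt ((n : ℝ) ^ d))⁻¹ := by
  have hnd : (0 : ℝ) < (n : ℝ) ^ d := pow_pos (by exact_mod_cast Nat.pos_of_ne_zero (NeZero.ne n)) d
  have hco : (0 : ℝ) ≤ Fintype.card o := Nat.cast_nonneg _
  have hsupp : ∀ b i, X b i ≠ 0 → |cornerW M n ρ b.1 - ρ i.1| ≤ Λ := by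
    intro b i hXne
    refine abs_cornerW_sub_le M n hΛ b.1 i.1 fun hq => hXne ?_
    have := hX b i
    rw [hq, mul_zero] at this
    exact norm_le_zero_iff.mp this
  have hrow : ∀ b : (Tor M × Fin d) × o, ∑ i : (Tor (fine n M) × Fin d) × o, ‖X b i‖ ≤ m * Fintype.card o := by
    intro b
    calc _ ≤ ∑ i : (Tor (fine n M) × Fin d) × o, m * qr n M b.1 i.1 := Finset.sum_le_sum fun i _ => hX b i
      _ = m * Fintype.card o := by
          rw [Fintype.sum_prod_type, Finset.sum_comm]
          simp only [Finset.sum_const, Finset.card_univ, nsmul_eq_mul, ← Finset.mul_sum]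
          rw [sum_qr_row, mul_one, mul_comm]
  have hcol : ∀ i : (Tor (fine n M) × Fin d) × o, ∑ b : (Tor M × Fin d) × o, ‖X b i‖ ≤ m * Fintype.card o * (1 / (n : ℝ) ^ d) := by
    intro i
    calc _ ≤ ∑ b : (Tor M × Fin d) × o, m * qr n M b.1 i.1 := Finset.sum_le_sum fun b _ => hX b i
      _ = m * Fintype.card o * (1 / (n : ℝ) ^ d) := by
          rw [Fintype.sum_prod_type, Finset.sum_comm]
          simp only [Finset.sum_const, Finset.card_univ, nsmul_eq_mul, ← Finset.mul_sum]
          rw [sum_qr_col]; ring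
  have h := opNorm_conjMat_sub_le_schur κ (fun b : (Tor M × Fin d) × o => cornerW M n ρ b.1)
    (fun p : (Tor (fine n M) × Fin d) × o => ρ p.1) X hΛ0 (by positivity) (by positivity) hsupp hrow hcol
  refine h.trans (le_of_eq ?_)
  rw [show m * ↑(Fintype.card o) * (m * ↑(Fintype.card o) * (1 / (n : ℝ) ^ d)) = (m * Fintype.card o) ^ 2 * ((n : ℝ) ^ d)⁻¹ by ring,
    Real.sqrt_mul (sq_nonneg _), Real.sqrt_sq (by positivity), Real.sqrt_inv]
  ring

/-- the same for the ISOMETRICALLY NORMALISED kernel `√(n^d)•X`: the factor `(√(n^d))⁻¹` is exactly absorbed. [folklore] -/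
theorem opNorm_conjMat_smul_sub_le_of_qr {X : Matrix ((Tor M × Fin d) × o) ((Tor (fine n M) × Fin d) × o) ℂ} {m : ℝ} (hm : 0 ≤ m)
    (hX : ∀ b i, ‖X b i‖ ≤ m * qr n M b.1 i.1) {ρ : Tor (fine n M) × Fin d → ℝ} {Λ : ℝ} (hΛ0 : 0 ≤ Λ)
    (hΛ : ∀ (z : Tor M) (μ : Fin d) (j j' : Fin d → Fin n) (t t' : ℕ), t < n → t' < n →
      |ρ (bpt n M z j + tstep (fine n M) μ t, μ) - ρ (bpt n M z j' + tstep (fine n M) μ t', μ)| ≤ Λ) (κ : ℝ) :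
    ‖conjMat κ (fun b : (Tor M × Fin d) × o => cornerW M n ρ b.1) (fun p : (Tor (fine n M) × Fin d) × o => ρ p.1)
          ((((Real.sqrt ((n : ℝ) ^ d) : ℝ) : ℂ)) • X) - (((Real.sqrt ((n : ℝ) ^ d) : ℝ) : ℂ)) • X‖
      ≤ (Real.exp (|κ| * Λ) - 1) * m * Fintype.card o := by
  have hs : 0 < Real.sqrt ((n : ℝ) ^ d) := Real.sqrt_pos.mpr (pow_pos (by exact_mod_cast Nat.pos_of_ne_zero (NeZero.ne n)) d)
  rw [conjMat_smul, ← smul_sub, norm_smul, Complex.norm_real, Real.norm_of_nonneg hs.le]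
  calc Real.sqrt ((n : ℝ) ^ d) * ‖_‖ ≤ Real.sqrt ((n : ℝ) ^ d) * ((Real.exp (|κ| * Λ) - 1) * m * Fintype.card o * (Real.sqrt ((n : ℝ) ^ d))⁻¹) :=
        mul_le_mul_of_nonneg_left (opNorm_conjMat_sub_le_of_qr M n hm hX hΛ0 hΛ κ) hs.le
    _ = (Real.exp (|κ| * Λ) - 1) * m * Fintype.card o := by field_simp

end Schur

/-! ## §1 (continued) The two instances on the tower: the free inner averaging `B_k` and the transport error `E_k` -/

section Instances

variable {ρ : (k : ℕ) → idx L M k → ℝ} {Λ : ℝ}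

/-- **`‖c(B_k) − B_k‖ ≤ card o·(e^{|κ|Λ} − 1)`** (`B_k = √(n_k^d)·Q_k ⊗ 1`, entries dominated by `qr` itself). [folklore] -/
theorem opNorm_conjMat_Bfree_sub_le (hΛ0 : 0 ≤ Λ) (k : ℕ)
    (hΛ : ∀ (z : Tor M) (μ : Fin d) (j j' : Fin d → Fin (lev L k)) (t t' : ℕ), t < lev L k → t' < lev L k →
      |ρ k (bpt (lev L k) M z j + tstep (fine (lev L k) M) μ t, μ) - ρ k (bpt (lev L k) M z j' + tstep (fine (lev L k) M) μ t', μ)| ≤ Λ)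
    (κ : ℝ) :
    ‖conjMat κ (fun b : (Tor M × Fin d) × o => cornerW M (lev L k) (ρ k) b.1) (fun p : idx L M k × o => ρ k p.1) (Bfree (o := o) L M k)
        - Bfree (o := o) L M k‖ ≤ Fintype.card o * (Real.exp (|κ| * Λ) - 1) := by
  have hX : ∀ (b : (Tor M × Fin d) × o) (i : idx L M k × o),
      ‖(QvOp (lev L k) M ⊗ₖ (1 : Matrix o o ℂ)) b i‖ ≤ 1 * qr (lev L k) M b.1 i.1 := by
    intro b i
    rw [Matrix.kroneckerMap_apply, norm_mul, one_mul]
    have h1 : ‖(1 : Matrix o o ℂ) b.2 i.2‖ ≤ 1 := by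
      rw [Matrix.one_apply]; split_ifs <;> simp
    calc ‖QvOp (lev L k) M b.1 i.1‖ * ‖(1 : Matrix o o ℂ) b.2 i.2‖ ≤ qr (lev L k) M b.1 i.1 * 1 :=
          mul_le_mul (norm_QvOp_le (lev L k) M b.1 i.1) h1 (norm_nonneg _) (qr_nonneg (lev L k) M b.1 i.1)
      _ = qr (lev L k) M b.1 i.1 := mul_one _
  have h := opNorm_conjMat_smul_sub_le_of_qr M (lev L k) zero_le_one hX hΛ0 hΛ κ
  rw [mul_one] at h
  rw [Bfree, sqrtVol, mul_comm]
  exact h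

/-- **`‖c(E_k) − E_k‖ ≤ card o·(e^{|κ|Λ} − 1)·τ`** (`E_k = √(n_k^d)·(Q_k(R_k) − Q_k ⊗ 1)`, entries dominated by `τ·qr` when every contour transporter
is within `τ` of `1`, `CovariantBlockAveraging.norm_Qcov_sub_kron_apply_le`). [folklore] -/
theorem opNorm_conjMat_Ecov_sub_le (hΛ0 : 0 ≤ Λ) (k : ℕ)
    (hΛ : ∀ (z : Tor M) (μ : Fin d) (j j' : Fin d → Fin (lev L k)) (t t' : ℕ), t < lev L k → t' < lev L k →
      |ρ k (bpt (lev L k) M z j + tstep (fine (lev L k) M) μ t, μ) - ρ k (bpt (lev L k) M z j' + tstep (fine (lev L k) M) μ t', μ)| ≤ Λ)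
    {R : (k : ℕ) → Fin d → (idx L M k → Matrix o o ℂ)} {τ : ℝ} (hτ : 0 ≤ τ)
    (hT : ∀ y j μ (t : Fin (lev L k)), ‖transport (fine (lev L k) M) (R k) μ (contour (lev L k) M y j μ t) - 1‖ ≤ τ) (κ : ℝ) :
    ‖conjMat κ (fun b : (Tor M × Fin d) × o => cornerW M (lev L k) (ρ k) b.1) (fun p : idx L M k × o => ρ k p.1) (Ecov L M R k)
        - Ecov L M R k‖ ≤ Fintype.card o * (Real.exp (|κ| * Λ) - 1) * τ := by
  have hX : ∀ (b : (Tor M × Fin d) × o) (i : idx L M k × o),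
      ‖(QcovLev L M R k - QvOp (lev L k) M ⊗ₖ (1 : Matrix o o ℂ)) b i‖ ≤ τ * qr (lev L k) M b.1 i.1 :=
    fun b i => norm_Qcov_sub_kron_apply_le (lev L k) M (contour (lev L k) M) hτ hT b i
  have h := opNorm_conjMat_smul_sub_le_of_qr M (lev L k) hτ hX hΛ0 hΛ κ
  rw [Ecov, sqrtVol]
  refine h.trans (le_of_eq ?_)
  ring

end Instances

/-! ## §2 The Gram difference under conjugation -/

section Gram

variable {β γ : Type*} [Fintype β] [DecidableEq β] [Fintype γ] [DecidableEq γ]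

/-- **THE GRAM DIFFERENCE UNDER CONJUGATION**: with a middle weight `σ` on the range index,
`‖c_ρρ((B+E)ᴴ(B+E) − BᴴB)‖ ≤ (b′ + e′)·e + e′·b` whenever `‖c_{κ,σρ}(B)‖ ≤ b`, `‖c_{κ,σρ}(E)‖ ≤ e`, `‖c_{−κ,σρ}(B)‖ ≤ b′`, `‖c_{−κ,σρ}(E)‖ ≤ e′`
(`(B+E)ᴴ(B+E) − BᴴB = (B+E)ᴴE + EᴴB`, `c_κ(Xᴴ) = (c_{−κ}X)ᴴ`). [folklore] -/
theorem opNorm_conjMat_gram_le (κ : ℝ) (σ : β → ℝ) (ρ : γ → ℝ) (B E : Matrix β γ ℂ) {b e b' e' : ℝ}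
    (hb : ‖conjMat κ σ ρ B‖ ≤ b) (he : ‖conjMat κ σ ρ E‖ ≤ e) (hb' : ‖conjMat (-κ) σ ρ B‖ ≤ b') (he' : ‖conjMat (-κ) σ ρ E‖ ≤ e') :
    ‖conjMat κ ρ ρ ((B + E)ᴴ * (B + E) - Bᴴ * B)‖ ≤ (b' + e') * e + e' * b := by
  have h0b : 0 ≤ b := (norm_nonneg _).trans hb
  have h0e' : 0 ≤ e' := (norm_nonneg _).trans he'
  have e1 : (B + E)ᴴ * (B + E) - Bᴴ * B = (B + E)ᴴ * E + Eᴴ * B := by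
    simp only [Matrix.conjTranspose_add, Matrix.add_mul, Matrix.mul_add]; abel
  rw [e1, conjMat_add, conjMat_mul κ ρ σ ρ, conjMat_mul κ ρ σ ρ, conjMat_conjTranspose, conjMat_conjTranspose, conjMat_add]
  have h1 : ‖(conjMat (-κ) σ ρ B + conjMat (-κ) σ ρ E)ᴴ‖ ≤ b' + e' := by
    rw [Matrix.l2_opNorm_conjTranspose]; exact (norm_add_le _ _).trans (add_le_add hb' he')
  have h2 : ‖(conjMat (-κ) σ ρ E)ᴴ‖ ≤ e' := by rw [Matrix.l2_opNorm_conjTranspose]; exact he'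
  calc _ ≤ ‖(conjMat (-κ) σ ρ B + conjMat (-κ) σ ρ E)ᴴ * conjMat κ σ ρ E‖ + ‖(conjMat (-κ) σ ρ E)ᴴ * conjMat κ σ ρ B‖ := norm_add_le _ _
    _ ≤ ‖(conjMat (-κ) σ ρ B + conjMat (-κ) σ ρ E)ᴴ‖ * ‖conjMat κ σ ρ E‖ + ‖(conjMat (-κ) σ ρ E)ᴴ‖ * ‖conjMat κ σ ρ B‖ :=
        add_le_add (Matrix.l2_opNorm_mul _ _) (Matrix.l2_opNorm_mul _ _)
    _ ≤ (b' + e') * e + e' * b :=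
        add_le_add (mul_le_mul h1 he (norm_nonneg _) (by linarith [(norm_nonneg _).trans hb']))
          (mul_le_mul h2 hb (norm_nonneg _) h0e')

end Gram

/-! ## §3 On Bałaban's (3.35)-class: `‖c(avgPert R k)‖` and the binder `hPc` from `hreg` and `hJ` -/

section Ends

variable (a : ℝ) (ha : 0 < a)

/-- the size of the conjugated Gram difference on the (3.35)-class with stencil oscillation `2`:
`Γ = (1 + ε + δ)·(ε + δτ) + (ε + δτ)·(1 + δ)`, `τ = e^{(d+1)α} − 1`, `ε = card o·τ`, `δ = card o·(e^{2|κ|} − 1)`. [folklore] -/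
def GammaAvg (co : ℕ) (d : ℕ) (α κ : ℝ) : ℝ :=
  (1 + co * (Real.exp ((d + 1 : ℕ) * α) - 1) + co * (Real.exp (|κ| * 2) - 1) + co * (Real.exp (|κ| * 2) - 1) * (Real.exp ((d + 1 : ℕ) * α) - 1))
    * (co * (Real.exp ((d + 1 : ℕ) * α) - 1) + co * (Real.exp (|κ| * 2) - 1) * (Real.exp ((d + 1 : ℕ) * α) - 1))
  + (co * (Real.exp ((d + 1 : ℕ) * α) - 1) + co * (Real.exp (|κ| * 2) - 1) * (Real.exp ((d + 1 : ℕ) * α) - 1))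
    * (1 + co * (Real.exp (|κ| * 2) - 1))

/-- the conjugated Neumann constant of row B3: `κ_avg,CT = a·Γ·(γ_D − J)⁻¹`. [folklore] -/
def kappaAvgCT (co : ℕ) (d : ℕ) (a α J κ : ℝ) : ℝ := a * GammaAvg co d α κ * (gamD d a - J)⁻¹

include ha in
/-- **`‖c(avgPert R k)‖ ≤ a·Γ`** at the canonical weights `rho k y` (stencil oscillation `2`), for the (3.35)-class `RegularTransporters R α β`:
the conjugated Gram difference of the transported block averaging, VANISHING with the background (`Γ → 0` as `α → 0`). [folklore] -/
theorem opNorm_conjMat_avgPert_le {R : (k : ℕ) → Fin d → (idx L M k → Matrix o o ℂ)} {α βr : ℝ} (hreg : RegularTransporters L M R α βr)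
    (κ : ℝ) (k : ℕ) (y : idx L M 0) :
    ‖conjMat κ (fun p : idx L M k × o => rho L M k y p.1) (fun p : idx L M k × o => rho L M k y p.1) (avgPert L M a R k)‖
      ≤ a * GammaAvg (Fintype.card o) d α κ := by
  have hα : 0 ≤ α := hreg.nonneg.1
  set τ : ℝ := Real.exp ((d + 1 : ℕ) * α) - 1 with hτdef
  have hτ : 0 ≤ τ := sub_nonneg.mpr (Real.one_le_exp (by positivity))
  set δ : ℝ := Fintype.card o * (Real.exp (|κ| * 2) - 1) with hδdef
  have hδ : 0 ≤ δ := mul_nonneg (Nat.cast_nonneg _) (sub_nonneg.mpr (Real.one_le_exp (by positivity)))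
  set ε : ℝ := Fintype.card o * τ with hεdef
  -- the stencil oscillation of the canonical weight and the contour transporters of the class
  have hΛ : ∀ (κ' : ℝ), ∀ (z : Tor M) (μ : Fin d) (j j' : Fin d → Fin (lev L k)) (t t' : ℕ), t < lev L k → t' < lev L k →
      |rho L M k y (bpt (lev L k) M z j + tstep (fine (lev L k) M) μ t, μ) - rho L M k y (bpt (lev L k) M z j' + tstep (fine (lev L k) M) μ t', μ)|
        ≤ 2 := fun _ z μ j j' t t' ht ht' => abs_rho_stencil_le L M k y z μ j j' ht ht'
  have hT : ∀ y' j μ (t : Fin (lev L k)), ‖transport (fine (lev L k) M) (R k) μ (contour (lev L k) M y' j μ t) - 1‖ ≤ τ :=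
    fun y' j μ t => norm_transport_contour_sub_one_le_of_regular hreg k y' μ j (le_of_lt t.is_lt)
  have hE : ‖Ecov L M R k‖ ≤ ε := opNorm_Ecov_le L M hα (fun k ν i => norm_transporter_sub_one_le hreg k ν i) k
  -- the four conjugated norms
  have hB : ∀ κ' : ℝ, |κ'| = |κ| →
      ‖conjMat κ' (fun b : (Tor M × Fin d) × o => cornerW M (lev L k) (rho L M k y) b.1) (fun p : idx L M k × o => rho L M k y p.1)
        (Bfree (o := o) L M k)‖ ≤ 1 + δ := by
    intro κ' hκ'
    have h := opNorm_conjMat_Bfree_sub_le L M (o := o) (ρ := fun k => rho L M k y) zero_le_two k (hΛ κ') κ'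
    rw [hκ'] at h
    exact (opNorm_conjMat_le_add κ' _ _ (Bfree (o := o) L M k)).trans (add_le_add (opNorm_Bfree_le L M k) h)
  have hEc : ∀ κ' : ℝ, |κ'| = |κ| →
      ‖conjMat κ' (fun b : (Tor M × Fin d) × o => cornerW M (lev L k) (rho L M k y) b.1) (fun p : idx L M k × o => rho L M k y p.1)
        (Ecov L M R k)‖ ≤ ε + δ * τ := by
    intro κ' hκ'
    have h := opNorm_conjMat_Ecov_sub_le L M (ρ := fun k => rho L M k y) zero_le_two k (hΛ κ') hτ hT κ'
    rw [hκ'] at h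
    exact (opNorm_conjMat_le_add κ' _ _ (Ecov L M R k)).trans (add_le_add hE h)
  have hneg : |(-κ)| = |κ| := abs_neg κ
  have hG := opNorm_conjMat_gram_le κ (fun b : (Tor M × Fin d) × o => cornerW M (lev L k) (rho L M k y) b.1)
    (fun p : idx L M k × o => rho L M k y p.1) (Bfree (o := o) L M k) (Ecov L M R k) (hB κ rfl) (hEc κ rfl) (hB (-κ) hneg) (hEc (-κ) hneg)
  -- `avgPert = a • gram`
  have e : avgPert L M a R k = (a : ℂ) • ((Bfree (o := o) L M k + Ecov L M R k)ᴴ * (Bfree L M k + Ecov L M R k)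
      - (Bfree (o := o) L M k)ᴴ * Bfree (o := o) L M k) := by
    rw [gram_eq]; rfl
  rw [e, conjMat_smul, norm_smul, Complex.norm_real, Real.norm_of_nonneg ha.le]
  refine mul_le_mul_of_nonneg_left (hG.trans (le_of_eq ?_)) ha.le
  simp only [GammaAvg, hεdef, hδdef, hτdef]
  ring

/-- **THE BINDER `hPc` FOR ROW B3's AVERAGING SUMMAND ON THE (3.35)-CLASS, FROM `hreg` AND THE `U = 1` CONJUGATION DEFECT ALONE** (no NE3):
`‖c(avgPert R k)·c((Δ_a^{(k)}⊗1)⁻¹)‖ ≤ kappaAvgCT (card o) d a α J κ` at the canonical weights. [folklore] -/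
theorem hPc_avgPert_of_regular {R : (k : ℕ) → Fin d → (idx L M k → Matrix o o ℂ)} {α βr : ℝ} (hreg : RegularTransporters L M R α βr)
    {κ J : ℝ} (hJ : ∀ (k : ℕ) (y : idx L M 0), ConjDefect (calDalev L M a ha k) κ (rho L M k y) J) (hJγ : J < gamD d a)
    (k : ℕ) (y : idx L M 0 × o) :
    ‖conjMat κ (fun p : idx L M k × o => rho L M k y.1 p.1) (fun p : idx L M k × o => rho L M k y.1 p.1) (avgPert L M a R k)
        * conjMat κ (fun p : idx L M k × o => rho L M k y.1 p.1) (fun p : idx L M k × o => rho L M k y.1 p.1)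
          (calDalev L M a ha k ⊗ₖ (1 : Matrix o o ℂ))⁻¹‖ ≤ kappaAvgCT (Fintype.card o) d a α J κ := by
  have hγ : 0 < gamD d a - J := sub_pos.mpr hJγ
  have hW := wCoercive_calDa_of_conjDefect (lev L k) (one_le_lev' L k) M a ha (hJ k y.1)
  calc _ ≤ ‖conjMat κ (fun p : idx L M k × o => rho L M k y.1 p.1) (fun p : idx L M k × o => rho L M k y.1 p.1) (avgPert L M a R k)‖
        * ‖conjMat κ (fun p : idx L M k × o => rho L M k y.1 p.1) (fun p : idx L M k × o => rho L M k y.1 p.1)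
          (calDalev L M a ha k ⊗ₖ (1 : Matrix o o ℂ))⁻¹‖ := Matrix.l2_opNorm_mul _ _
    _ ≤ (a * GammaAvg (Fintype.card o) d α κ) * (gamD d a - J)⁻¹ :=
        mul_le_mul (opNorm_conjMat_avgPert_le L M a ha hreg κ k y.1) (opNorm_conjMat_kron_inv_le_of_wCoercive hW hγ) (norm_nonneg _)
          (by have := opNorm_conjMat_avgPert_le L M a ha hreg κ k y.1; exact (norm_nonneg _).trans this)
    _ = kappaAvgCT (Fintype.card o) d a α J κ := by rw [kappaAvgCT]

end Ends

end Summit.QuantumFields.BalabanUV.T4Continuum.CTAveragingSummandHbd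

end
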